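import Summits.AtomisticToContinuum.Crystallization.Theorems.FrustratedLawDichotomyStrainedPatchHomEntryLeafHTMustPassB

/-!
# ★★★ MUST-PASS CELL of the analytic-slab leaf at `0.8 t_b`, part C: the inner sub-tree closes the confined box and the leaf FIRES
# (27623 `(H) HomFloor (1/625)`, hcp half; critic rows 1108 (3) / 1110 (2): «entryLeafOKHT ☐» → ■ at a T-side cell)

decomp-a2c hand-1 g29 (crux `AperiodicFrustratedLawGap`, stmt-AtomisticToContinuum-27623).  `treeOK_A`: the quick hcp verdict `entryLeafOKHQ muRec` closes all 8
leaves of the inner sub-tree `tA` over the ROUNDED confined box `htWr pA cA wA = (2.05, 2.73, 0.97)·10⁻³` (one `decide`); `htCertSide_A`: every certificate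
conjunct (assembled from parts A/B by rewriting); ★★★ `entryLeafOKHT4Q_A : entryLeafOKHT4Q muRec pA tA cA wA = true` — the analytic-slab leaf closes the
cell `U⋆ + 0.8 t_b d₀ ± 2⁻¹³ × ξ⋆ ± 1.25·10⁻³` END TO END: outside the slab every shuffle of the cell is exempt (zero-step prune), inside it the quick
verdict certifies the dichotomy on 8 sub-boxes; by `entryLeafOKHT4Q_sound` the `hver` conclusion holds on the whole cell.

Kernel facts + assembly; 0 sorry; standard axioms.  `--supports stmt-AtomisticToContinuum-27623`.
-/

namespace Summit.AtomisticToContinuum.Crystallization.Theorems.FrustratedLawDichotomyStrainedPatchHomEntryLeafHT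

open Literature.Analysis.ValidatedNumerics.Numerics
open Summit.AtomisticToContinuum.Crystallization.Theorems.FrustratedLawDichotomyStrainedPatchHomCurvLJ (curvCheckLJM)
open Summit.AtomisticToContinuum.Crystallization.Theorems.FrustratedLawDichotomyStrainedPatchHomForceJacN (forceJacCheckN)
open Summit.AtomisticToContinuum.Crystallization.Theorems.FrustratedLawDichotomyStrainedPatchHomForceHcp (xiBallOK)
open Summit.AtomisticToContinuum.Crystallization.Theorems.FrustratedLawDichotomyStrainedPatchHomCertTree (CertTree treeOK)
open Summit.AtomisticToContinuum.Crystallization.Theorems.FrustratedLawDichotomyStrainedPatchHomEntryQuickHcp (entryLeafOKHQ)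
open Summit.AtomisticToContinuum.Crystallization.Theorems.FrustratedLawDichotomyStrainedPatchHomEntryTable (muRec)

/-- ★★ KERNEL: the inner sub-tree — `entryLeafOKHQ muRec` closes the 8 sub-boxes of the rounded confined box. -/
theorem treeOK_A : treeOK (entryLeafOKHQ muRec) tA cA (htWr pA cA wA) = true := by
  decide +kernel

/-- The three chunk slope constants sum below `pA.Gs`. [arithmetic on the kernel facts] -/
theorem htGs_sum_A : decide (htGs cA wA (htNear cA wA) + htGs cA wA (htFar1 cA wA) + htGs cA wA (htFar2 cA wA) ≤ pA.Gs) = true := by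
  have h1 := slope_near_A
  have h2 := slope_far1_A
  have h3 := slope_far2_A
  simp only [Bool.and_eq_true, decide_eq_true_eq] at h1 h2 h3 ⊢
  have e : pA.Gs = 578500000000 := rfl
  rw [e]
  linarith [h1.2, h2.2, h3.2]

/-- ★★ Every certificate conjunct of the slab leaf holds on the cell. [assembly by rewriting] -/
theorem htCertSide_A : htCertSide pA cA wA = true := by
  have h1 := slope_near_A
  have h2 := slope_far1_A
  have h3 := slope_far2_A
  simp only [Bool.and_eq_true] at h1 h2 h3
  rw [htCertSide, show pA.D = DA from rfl, show pA.lam₁ = 211106232532992 from rfl, show pA.lam₂ = -2814749767106 from rfl,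
    show pA.lam₃ = -2814749767106 from rfl, xiBallOK_A, htROK_A, htCertOK_A, curvCheckLJM_A, far1_A, far2_A, h1.1, h2.1, h3.1, htGs_sum_A]
  simp

/-- ★★★ **THE ANALYTIC-SLAB LEAF FIRES ON THE MUST-PASS CELL** (`0.8 t_b` on the worst ray, `U 2⁻¹³ × ξ 1.25·10⁻³`). -/
theorem entryLeafOKHT4Q_A : entryLeafOKHT4Q muRec pA tA cA wA = true := by
  rw [entryLeafOKHT4Q, entryLeafOKHT4, htCertSide_A, treeOK_A]
  simp

end Summit.AtomisticToContinuum.Crystallization.Theorems.FrustratedLawDichotomyStrainedPatchHomEntryLeafHT
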